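import Summits.Ventures.PercRepro.Night2ExcessMassUnsat
import Summits.Ventures.PercRepro.Night2FatFaceCap
import Summits.Ventures.PercRepro.Night2FatFaceInj
import Summits.Ventures.PercRepro.Night2ThreeTwoArith
import Summits.Ventures.PercRepro.Night2ThreeTwoSums
import Summits.Ventures.PercRepro.Night2SeriesClassesBases
import Summits.Ventures.PercRepro.Night2ThreeOneFatCells

/-!
# PercRepro — **THE GENERIC PART OF THE `(7, 5)` CELL `(3, 2)` AT EVERY SIZE** (night-2, gen 24)

The cell `(3, 2)` (`|E ∖ G| = 3`, two coloops, `ρ = 4`, `capDG = 5/12`) has `c′ = cPrimeDGP < 0`: a middle target with two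
fat covering preimages is oversubscribed, so the bases-only chain does not apply.  But a middle target has `≤ 2` thin
covering preimages, at most `#fatClosures` of them fat, and the others miss `≥ 3` points; when there is ONE fat
closure and NO thin member misses exactly three points, every middle target has `L1 ≤ Φ/5 + Φ/7 = 2/5 < 5/12` —
no middle target is saturated (`Night2ExcessMassUnsat`) and the residual capacity is `≥ 1/60`.  With the chord
excess `(n + 56)/(20n)` and the one-fat-pair count the count sum is `≥ 1` at EVERY `n ≥ 7` (`Night2ThreeTwoArith`):

* `L1_le_of_fat_le_gen` — the layer-1 request of a middle target with `≤ f` fat preimages, the others missing `≥ m₀`;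
* **`localShadowHall_three_two_five_generic`** — (LI_G) at every rank-6 flat of the cell `(3, 2)` with a fat
  2-cocircuit `{p, x}`, at most one fat thin closure and no thin member missing exactly `3` points, for every `|G|`.
-/

namespace PercRepro.Shadow

open Finset PerFlat ThmH

variable {α : Type*} [DecidableEq α] {M : Matroid α} [M.Finite]

open scoped Classical in
/-- **The layer-1 request of a middle target with `≤ f` fat thin covering preimages, the others missing `≥ m₀`
points**: `L1 S ≤ f·Φ/(2+d) + (ρ − 2 − f)·Φ/(m₀ + d)`. -/
theorem L1_le_of_fat_le_gen {q d ρ f m₀ : ℕ} {G : Finset α} (hG : G ∈ flatsQ M (q + 1))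
    (hd : (gr M \ G).card = d) (hdq : d ≤ q) (hk : kColoops M G + ρ = q + 1)
    (hs : ∀ e ∈ gr M, ∀ f ∈ gr M, e ≠ f → rkN M {e, f} = 2) (hl : ∀ e ∈ gr M, M.Indep {e}) {S : Finset α}
    (hS : S ∈ shadowAt M (q + 2) q (Uq M (q + 2) q) G) (hcard : ρ + 1 ≤ (S \ coloops M G).card)
    (hf : ((coverPreimages M (Uq M (q + 2) q) G S).filter
      (fun B => B ∉ lay0 M q G ∧ (G \ clF M B).card ≤ 2)).card ≤ f)
    (hm₀ : ∀ B ∈ coverPreimages M (Uq M (q + 2) q) G S, B ∉ lay0 M q G → ¬ (G \ clF M B).card ≤ 2 →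
      m₀ ≤ (G \ clF M B).card) (h2m : 2 ≤ m₀) :
    L1 M q G S ≤ (f : ℚ) * reqDGP q d 2 + ((ρ : ℚ) - 2 - f) * reqDGP q d m₀ := by
  have hd' : (gr M \ G).card ≤ q := by omega
  unfold L1
  set P := (coverPreimages M (Uq M (q + 2) q) G S).filter (fun B => B ∉ lay0 M q G) with hP
  have hthin : ∀ B ∈ P, B ∈ thinMembers M q G := by
    intro B hB
    rw [hP, Finset.mem_filter, mem_coverPreimages] at hB
    exact mem_thinMembers.2 ⟨hB.1.1, hB.2⟩
  rw [← Finset.sum_filter_add_sum_filter_not P (fun B => (G \ clF M B).card ≤ 2)]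
  have hFcard : (P.filter (fun B => (G \ clF M B).card ≤ 2)).card ≤ f := by
    rw [hP, Finset.filter_filter]; exact hf
  have hPcard := card_thin_coverPreimages_add_two_le hG hd' hk hs hl hS hcard
  rw [← hP] at hPcard
  have hsplit := Finset.card_filter_add_card_filter_not (s := P) (fun B => (G \ clF M B).card ≤ 2)
  have hfat : ∑ B ∈ P.filter (fun B => (G \ clF M B).card ≤ 2), req M q B ≤
      ((P.filter (fun B => (G \ clF M B).card ≤ 2)).card : ℚ) * reqDGP q d 2 := by
    rw [← nsmul_eq_mul, ← Finset.sum_const]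
    apply Finset.sum_le_sum
    intro B hB
    rw [Finset.mem_filter] at hB
    have hBt := hthin B hB.1
    have h2 : 2 ≤ (G \ clF M B).card :=
      two_le_card_sdiff_of_not_lay0 hG hd' (mem_thinMembers.1 hBt).1 (mem_thinMembers.1 hBt).2
    unfold reqDGP
    exact req_le_of_spread hG hd hBt h2
  have hnot : ∑ B ∈ P.filter (fun B => ¬ (G \ clF M B).card ≤ 2), req M q B ≤
      ((P.filter (fun B => ¬ (G \ clF M B).card ≤ 2)).card : ℚ) * reqDGP q d m₀ := by
    rw [← nsmul_eq_mul, ← Finset.sum_const]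
    apply Finset.sum_le_sum
    intro B hB
    rw [Finset.mem_filter] at hB
    have hBt := hthin B hB.1
    have hBP := hB.1
    rw [hP, Finset.mem_filter] at hBP
    have h3 : m₀ ≤ (G \ clF M B).card := hm₀ B hBP.1 hBP.2 hB.2
    unfold reqDGP
    exact req_le_of_spread hG hd hBt h3
  have hR : reqDGP q d m₀ ≤ reqDGP q d 2 := by
    unfold reqDGP phiQ
    apply div_le_div_of_nonneg_left (by positivity) (by positivity)
    have : (2 : ℚ) ≤ (m₀ : ℚ) := by exact_mod_cast h2m
    push_cast; linarith
  have hR3 := reqDGP_nonneg q d m₀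
  set a := (P.filter (fun B => (G \ clF M B).card ≤ 2)).card with ha
  set b := (P.filter (fun B => ¬ (G \ clF M B).card ≤ 2)).card with hb
  have haf : (a : ℚ) ≤ f := by exact_mod_cast hFcard
  have hab : (a : ℚ) + b + 2 ≤ ρ := by
    have : a + b + 2 ≤ ρ := by omega
    exact_mod_cast this
  calc ∑ B ∈ P.filter (fun B => (G \ clF M B).card ≤ 2), req M q B +
        ∑ B ∈ P.filter (fun B => ¬ (G \ clF M B).card ≤ 2), req M q B
      ≤ (a : ℚ) * reqDGP q d 2 + (b : ℚ) * reqDGP q d m₀ := add_le_add hfat hnot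
    _ = (a : ℚ) * (reqDGP q d 2 - reqDGP q d m₀) + ((a : ℚ) + b) * reqDGP q d m₀ := by ring
    _ ≤ (f : ℚ) * (reqDGP q d 2 - reqDGP q d m₀) + ((ρ : ℚ) - 2) * reqDGP q d m₀ := by
        apply add_le_add
        · exact mul_le_mul_of_nonneg_right haf (by linarith)
        · exact mul_le_mul_of_nonneg_right (by linarith) hR3
    _ = (f : ℚ) * reqDGP q d 2 + ((ρ : ℚ) - 2 - f) * reqDGP q d m₀ := by ring

open scoped Classical in
/-- **THE GENERIC `(3, 2)` CELL AT EVERY SIZE**: a rank-6 flat `G` with `|E ∖ G| = 3`, two coloops, a fat 2-cocircuit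
`{p, x}` through the coloops, at most one fat thin closure and no thin member missing exactly three points satisfies
(LI_G) — for every `|G|`. -/
theorem localShadowHall_three_two_five_generic {G : Finset α} (hG : G ∈ flatsQ M (5 + 1))
    (hd : (gr M \ G).card = 3) (hk : kColoops M G = 2)
    (hs : ∀ e ∈ gr M, ∀ f ∈ gr M, e ≠ f → rkN M {e, f} = 2) (hl : ∀ e ∈ gr M, M.Indep {e})
    (hcl : (fatClosures M 5 G 2).card ≤ 1) (h3 : ∀ B ∈ thinMembers M 5 G, (G \ clF M B).card ≠ 3)
    {p x : α} (hpx : p ≠ x) (hK : ∀ a ∈ ({p, x} : Finset α), a ∉ coloops M G)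
    (hH₀ : M.eRk ((G \ {p, x} : Finset α) : Set α) ≤ ((5 : ℕ) : ℕ∞)) :
    LocalShadowHall M 5 G := by
  have hk' : kColoops M G + 4 = 5 + 1 := by omega
  have hd' : (gr M \ G).card ≤ 5 := by omega
  by_cases hn7 : 7 ≤ G.card - kColoops M G
  swap
  · push Not at hn7
    exact localShadowHall_of_lossFair hG hd'
      (fun B hB => absurd (thin_card_bound (ρ := 4) hG hd (by omega) hk' hB) (by omega))
  have hKG : coloops M G ⊆ G := fun y hy => (mem_coloops.1 hy).1
  have hnK : (G \ coloops M G).card = G.card - kColoops M G := by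
    rw [Finset.card_sdiff_of_subset hKG, ← kColoops_eq_card_coloops]
  -- the middle targets: `L1 ≤ 2/5`
  have hL1 : ∀ S ∈ shadowAt M (5 + 2) 5 (Uq M (5 + 2) 5) G, 4 + 1 ≤ (S \ coloops M G).card →
      L1 M 5 G S ≤ 2 / 5 := by
    intro S hS hcard
    have hf : ((coverPreimages M (Uq M (5 + 2) 5) G S).filter
        (fun B => B ∉ lay0 M 5 G ∧ (G \ clF M B).card ≤ 2)).card ≤ 1 :=
      (card_fat_coverPreimages_le_card_fatClosures (q := 5) (G := G) (S := S) 2).trans hcl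
    have hm₀ : ∀ B ∈ coverPreimages M (Uq M (5 + 2) 5) G S, B ∉ lay0 M 5 G → ¬ (G \ clF M B).card ≤ 2 →
        4 ≤ (G \ clF M B).card := by
      intro B hB hnl hgt
      have hBt : B ∈ thinMembers M 5 G := mem_thinMembers.2 ⟨(mem_coverPreimages.1 hB).1, hnl⟩
      have := h3 B hBt
      omega
    have h := L1_le_of_fat_le_gen (d := 3) (ρ := 4) (f := 1) (m₀ := 4) hG hd (by norm_num) hk' hs hl hS hcard hf hm₀
      (by norm_num)
    have e : (1 : ℚ) * reqDGP 5 3 2 + ((4 : ℕ) - 2 - (1 : ℕ) : ℚ) * reqDGP 5 3 4 = 2 / 5 := by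
      unfold reqDGP phiQ; norm_num
    push_cast at h e
    linarith
  have hns : ∀ S ∈ shadowAt M (5 + 2) 5 (Uq M (5 + 2) 5) G, 4 + 1 ≤ (S \ coloops M G).card →
      L1 M 5 G S ≤ capS M 5 G S := by
    intro S hS hcard
    have h1 := hL1 S hS hcard
    have h2 := capS_ge_one_sub_kColoops (q := 5) hd (subset_G_of_mem_shadowAt hS)
    rw [hk] at h2
    unfold phiQ at h2
    norm_num at h2
    linarith
  have hcap : ∀ S ∈ shadowAt M (5 + 2) 5 (Uq M (5 + 2) 5) G, 4 + 1 ≤ (S \ coloops M G).card →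
      (1 / 60 : ℚ) ≤ cap2 M 5 G S := by
    intro S hS hcard
    have h1 := hL1 S hS hcard
    have h2 := capS_ge_one_sub_kColoops (q := 5) hd (subset_G_of_mem_shadowAt hS)
    have h0 := cap2_ge_capS_sub_L1_of_le hG hd' S
    rw [hk] at h2
    unfold phiQ at h2
    norm_num at h2
    linarith
  set n := G.card - kColoops M G with hn
  have hc₁ : ({p, x} : Finset α).card = 2 := Finset.card_pair hpx
  refine localShadowHall_excess_of_count_unsat (d := 3) (ρ := 4) hG hd (by norm_num) hk' (by norm_num) hns
    (c'' := (1 / 60 : ℚ)) (by norm_num) hcap (E := ((n : ℚ) + 56) / (20 * (n : ℚ))) (excess_three_two_pos hn7) ?_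
    (cnt := fun s => (cntSeries 4 s [2] : ℚ)) ?_ ?_ ?_
  · intro S _ T hT
    have hT' : T ∈ (S \ coloops M G).powersetCard 4 := by
      unfold coverBases at hT
      exact (Finset.mem_filter.1 hT).1
    have h := sum_faceLoss_union_le (a := ((n : ℚ) + 2) / (5 * (n : ℚ))) (b := 1 / (5 * (n : ℚ))) hG hd (by norm_num)
      hk' (by omega) hs hl (by positivity) (by rw [hnK]; exact chord_three_two hn7)
      (by rw [hnK, hk, excessBound_three_two_eq hn7]; exact (excess_three_two_pos hn7).le) hT'
    rw [hnK, hk, excessBound_three_two_eq hn7] at h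
    exact h
  · intro s h1 _
    exact cntSeries_four_two_pos (by omega)
  · intro S hSG
    have h := card_coverBases_le_cntSeries hk' [({p, x} : Finset α)] (List.pairwise_singleton _ _) ?_ ?_ hSG
    · simpa only [List.map_cons, List.map_nil, hc₁] using h
    · intro C hC
      rw [List.mem_singleton] at hC
      rw [hC, hc₁]; omega
    · intro C hC a ha b hb hab
      rw [List.mem_singleton] at hC
      rw [hC] at ha hb
      exact ⟨coloops_subset_sdiff_pair (hK a ha) (hK b hb), pair_cocircuit hH₀ a ha b hb hab⟩
  · exact countSum_three_two hn7

end PercRepro.Shadow
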